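import Mathlib
import HarnessLib
import Summits.AtomisticToContinuum.FouriersLaw.Theses.JunctionLocality
import Summits.AtomisticToContinuum.FouriersLaw.Theorems.JunctionLocalityDefs
import Summits.AtomisticToContinuum.FouriersLaw.Theorems.JunctionLocalityConductanceLowerBoundStubShortTimeDipoleFloorAux1
import Summits.AtomisticToContinuum.FouriersLaw.Theorems.JunctionLocalityConductanceLowerBoundStubShortTimeDipoleFloorAux2

/-!
# Short-time dipole floor, helper 3: reduction of the floor to an `N`-uniform floor on the contact power pairing

Helper (`--supports stmt-AtomisticToContinuum-11749`) for stub `stub_shortTimeDipoleFloor` (S) of line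
`kick-dipole-no-collapse`, crux `JunctionLocality.ConductanceLowerBound`.

Composition of helpers 1 and 2: for the pinned anharmonic chain (all parameters `> 0`), `T > 0`, if the contact power pairing
`Φ_N(s) = ∫ (p_0 ∂_{q_0}H) · (κ_s J) dμ_T` stays `≥ T²/4` for `s ∈ [0, t₁]` and every `N ≥ 2`, then
`𝔇_N(t₀) = bookedDipole … t₀ ≥ γ t₀²/8` for every `t₀ ∈ (0, t₁]` with `2γ t₀ ≤ 1` and every `N ≥ 2`
(`helper_kdShortTimeReduction`): `𝒥_N = −(2γ/T²)ψ`, `ψ(r) = ∫₀ʳ (−Φ_N − 2γψ)` (helper 2), the damped comparison lemma and the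
kernel-floor-to-dipole-floor step (helper 1).
-/

noncomputable section

open MeasureTheory ProbabilityTheory Filter Topology Set
open scoped NNReal ENNReal BigOperators
open Literature.MathematicalPhysics.KineticTheory.HeatConduction
open Summit.AtomisticToContinuum.FouriersLaw.Theorems.JunctionLocality
open Summit.AtomisticToContinuum.FouriersLaw.Theorems
open Summit.AtomisticToContinuum.FouriersLaw.Theorems.SubdiffusiveBondHeat

namespace Summit.AtomisticToContinuum.FouriersLaw.Cruxes.ConductanceLowerBound.KickDipoleNoCollapse

variable {N : ℕ}

/-! ### The reduction: an `N`-uniform floor on the contact power pairing gives the dipole floor -/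

/-- **Registered helper `helper_kdShortTimeReduction` (stub S, line `kick-dipole-no-collapse`): REDUCTION OF THE SHORT-TIME
DIPOLE FLOOR TO AN `N`-UNIFORM FLOOR ON THE CONTACT POWER PAIRING.**  For the pinned anharmonic chain (all parameters `> 0`) and
`T > 0`: if for some `t₁ > 0` the contact power pairing `Φ_N(s) = ∫ (p_0 ∂_{q_0}H) · (κ_s J) dμ_T` satisfies `Φ_N(s) ≥ T²/4` for
all `N ≥ 2` and `s ∈ [0, t₁]` (at `s = 0` it equals `(T²/2) ∫ V''(q_1 − q_0) dμ_T ≥ T²/2`; the hypothesis is its `N`-uniform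
short-time persistence), then for every `t₀ ∈ (0, t₁]` with `2γ t₀ ≤ 1` and every `N ≥ 2`, `𝔇_N(t₀) ≥ γ t₀²/8`.
Proof: `𝒥_N = −(2γ/T²) ψ` (`kickKernel_eq_pairing_kin`), `ψ(r) = ∫₀ʳ (−Φ_N − 2γ ψ)` (`pairing_kin_dynkin`), the comparison
lemma `le_of_dampedIntegralEq_of_forcing_le` (`ψ(r) ≤ −(T²/(8γ))(1 − e^{−2γr})`, i.e. `𝒥_N(r) ≥ (1 − e^{−2γr})/4`) and
`sq_floor_of_kernel_floor`. -/
theorem helper_kdShortTimeReduction : ∀ ω₂ lam β γ : ℝ, 0 < ω₂ → 0 < lam → 0 < β → 0 < γ → ∀ T : ℝ, 0 < T → ∀ t₁ : ℝ, 0 < t₁ → (∀ (N : ℕ) (hN : 2 ≤ N), ∀ s ∈ Set.Icc (0:ℝ) t₁, T ^ 2 / 4 ≤ ∫ z, (z.2 ⟨0, by omega⟩ * partialQ ⟨0, by omega⟩ ((pinnedChain ω₂ lam β γ).hamiltonian N) z) * evolve (pinnedChain ω₂ lam β γ) N T (totalCurrentObs (pinnedChain ω₂ lam β γ) N) s z ∂((pinnedChain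 ω₂ lam β γ).gibbsMeasure N T)) → ∀ t₀ : ℝ, 0 < t₀ → t₀ ≤ t₁ → 2 * γ * t₀ ≤ 1 → ∀ N : ℕ, 2 ≤ N → γ * t₀ ^ 2 / 8 ≤ bookedDipole (pinnedChain ω₂ lam β γ) N T t₀ := by
  intro ω₂ lam β γ hω hl hβ hγ T hT t₁ ht₁ hΦ t₀ ht₀ ht₀₁ h2γ N hN2
  have hN : 0 < N := by omega
  set P := pinnedChain ω₂ lam β γ with hP
  haveI : IsProbabilityMeasure (P.gibbsMeasure N T) := pinnedChain_isProbabilityMeasure_gibbsMeasure hω hl.le hβ.le γ N hT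
  set ψ : ℝ → ℝ := fun s => ∫ z, totalCurrentObs P N z *
    evolve P N T (fun y : PhaseSpace N => y.2 ⟨0, hN⟩ ^ 2 / 2) s z ∂(P.gibbsMeasure N T) with hψ
  set Φ : ℝ → ℝ := fun s => ∫ z, (z.2 ⟨0, hN⟩ * partialQ ⟨0, hN⟩ (P.hamiltonian N) z) *
    evolve P N T (totalCurrentObs P N) s z ∂(P.gibbsMeasure N T) with hΦdef
  obtain ⟨C, -, hec, heb, hac, hab, -, -⟩ := contactObs_facts hω hl hβ hγ hN hT
  have hJc : Continuous (totalCurrentObs P N) := OddSectorIrreversibility.continuous_totalBondCurrent ω₂ lam β γ N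
  obtain ⟨-, he2, -, -, -⟩ := expClass_facts hω hl hβ hγ hN hT hec heb 0
  obtain ⟨-, ha2, -, -, -⟩ := expClass_facts hω hl hβ hγ hN hT hac hab 0
  obtain ⟨-, -, -, -, hJ2⟩ := evolve_totalCurrentObs_facts hω hl hβ hγ hN hT 0
  have hinv : ∀ s : ℝ≥0, (P.gibbsMeasure N T).bind (P.transitionKernel N T T s) = P.gibbsMeasure N T := fun s =>
    pinnedChain_gibbsMeasure_bind_transitionKernel hω hl.le hβ.le hγ.le hN hT s
  -- time integrability of the two pairings (bounded measurable)
  have hψi : IntervalIntegrable ψ volume 0 t₁ :=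
    pinnedChain_intervalIntegrable_kernelPairing hω hl.le hβ.le hγ.le N T T (P.gibbsMeasure N T) hinv
      hJc.measurable hec.measurable hJ2 he2 0 t₁
  have hΦi : IntervalIntegrable Φ volume 0 t₁ :=
    pinnedChain_intervalIntegrable_kernelPairing hω hl.le hβ.le hγ.le N T T (P.gibbsMeasure N T) hinv
      hac.measurable hJc.measurable ha2 hJ2 0 t₁
  have hψI : IntegrableOn ψ (Set.Icc 0 t₁) := (intervalIntegrable_iff_integrableOn_Icc_of_le ht₁.le).1 hψi
  have hΦI : IntegrableOn (fun s => -Φ s) (Set.Icc 0 t₁) :=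
    ((intervalIntegrable_iff_integrableOn_Icc_of_le ht₁.le).1 hΦi).neg
  -- the comparison lemma
  have key := le_of_dampedIntegralEq_of_forcing_le (ψ := ψ) (b := fun s => -Φ s) (α := 2 * γ) (c := T ^ 2 / 4)
    (t₁ := t₁) (by positivity) ht₁.le hψI hΦI
    (fun r hr => pairing_kin_dynkin hω hl hβ hγ hN hT hN2 hr.1)
    (fun s hs => by have h := hΦ N hN2 s hs; simp only [neg_le_neg_iff]; exact h)
  -- the kernel floor on `[0, t₀]`
  have hfloor : ∀ r ∈ Set.Icc 0 t₀, (1 - Real.exp (-(2 * γ * r))) / 4 ≤ kickKernel P N T r := by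
    intro r hr
    rw [kickKernel_eq_pairing_kin hω hl hβ hγ hN hT r]
    have h := key r ⟨hr.1, hr.2.trans ht₀₁⟩
    have hT2 : 0 < T ^ 2 := by positivity
    have e : -(2 * γ / T ^ 2) * ψ r = (2 * γ / T ^ 2) * (-ψ r) := by ring
    rw [show (1 - Real.exp (-(2 * γ * r))) / 4 = (2 * γ / T ^ 2) * (T ^ 2 / 4 / (2 * γ) * (1 - Real.exp (-(2 * γ * r)))) by
      field_simp]
    rw [e]
    exact mul_le_mul_of_nonneg_left (by linarith) (by positivity)
  have hkint : IntervalIntegrable (kickKernel P N T) volume 0 t₀ := by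
    have e : kickKernel P N T = fun r => -(2 * γ / T ^ 2) * ψ r := funext fun r => kickKernel_eq_pairing_kin hω hl hβ hγ hN hT r
    rw [e]
    exact (hψi.mono_set (by rw [uIcc_of_le ht₀.le, uIcc_of_le ht₁.le]; exact Icc_subset_Icc le_rfl ht₀₁)).const_mul _
  exact sq_floor_of_kernel_floor hγ ht₀.le h2γ hkint hfloor

end Summit.AtomisticToContinuum.FouriersLaw.Cruxes.ConductanceLowerBound.KickDipoleNoCollapse

end
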